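/-
Copyright (c) 2026. All rights reserved.
Released under Apache 2.0 license as described in the file LICENSE.
Authors: abc-iut cell, seat abc-iut-L4-t15 (gen 6).
-/
import Mathlib.GroupTheory.Commutator.Basic
import Mathlib.GroupTheory.QuotientGroup.Basic
import Mathlib.GroupTheory.Index
import Mathlib.GroupTheory.PGroup
import Mathlib.GroupTheory.OrderOfElement
import Mathlib.Algebra.Group.Subgroup.Finite
import Mathlib.Tactic.Group

/-!
# Chief factors inside a normal `p`-subgroup under a "metacyclic" action: fixed-point-free generators

Setting (a finite group `G`, the shape of a finite quotient of the absolute Galois group of a `p`-adic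
field): `P ⊴ G` is a normal `p`-subgroup and `t, s ∈ G` satisfy

* `(T1)` every conjugate of `t` lies in `⟨t⟩P`:  `∀ g, ∃ a, ∃ y ∈ P, g t g⁻¹ = t ^ a * y`;
* `(T2)` `t ^ e ∈ P` for some `e` coprime to `p`;
* `(T3)` every conjugate of `s` lies in `⟨t⟩ s P`:  `∀ g, ∃ a, ∃ y ∈ P, g s g⁻¹ = t ^ a * s * y`;
* `(T4)` `G` is generated by `P ∪ {t, s}`.

(For `G = G_k` modulo an open normal subgroup: `P` = image of wild inertia, `t` = a generator of tame
inertia, `s` = a Frobenius lift.)  Let `N ⊴ G`, `N ≤ P`, be quasi-minimal normal with maximal proper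
normal subgroup `Z` (`Literature/GroupTheory/QuasiMinimalNormal.lean`), so that `N/Z` is a chief factor
of `G` and `⁅N, P⁆ ≤ Z`.  This file proves, by elementary commutator calculus:

* `fpf_or_triv_of_conj_mem_zpowers_mul` — DICHOTOMY for `t`: either `t` acts fixed-point-freely on `N/Z`
  (`⁅n,t⁆ ∈ Z → n ∈ Z`) or trivially (`⁅n,t⁆ ∈ Z` for all `n ∈ N`)  [the set `{n | ⁅n,t⁆ ∈ Z}` is a
  `G`-normal subgroup between `Z` and `N`];
* `fpf_s_of_triv_t` — if `t` acts trivially then `s` acts fixed-point-freely (else `N/Z` would be central,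
  contradicting `N = ⁅N, G⁆`);
* `fpf_conj` — fixed-point-freeness passes to all conjugates;
* `exists_commutator_inv_mul_mem_of_fpf` — SOLVABILITY: if `u` acts fixed-point-freely on the abelian
  section `N/Z` then `n ↦ ⁅n, u⁆` is onto `N/Z`: `∀ κ ∈ N, ∃ a ∈ N, κ⁻¹ ⁅a, u⁆ ∈ Z` (counting);
* the companion file `PByMetacyclicTopLayer.lean` derives from these, in either case,
  `Z ≤ ⁅N, P⁆ ⊔ ⁅Z, G⁆` (the top layer of the hypercentral part `Z` is reached by commutators with `P`).

These are the chief-factor facts behind the bounded commutator width theorem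
`Literature/GroupTheory/BoundedCommutatorWidthPByMetacyclic.lean` (cell abc-iut, GAP-LEDGER G-L3d2g2-1;
an elementary replacement, for this class of groups, of the Nikolov–Segal "Key Theorem",
Ann. of Math. 165 (2007), §§4–7).  Finite group theory over Mathlib; no definitions, no instances.
-/

namespace Literature.GroupTheory

open scoped commutatorElement

variable {G : Type*} [Group G]

/-! ### Commutator calculus modulo a normal subgroup -/

/-- If `⁅n, u⁆ ∈ Z` for a normal subgroup `Z`, then `⁅n, u ^ k⁆ ∈ Z` for all `k`. [folklore] -/
private theorem commutator_pow_mem (Z : Subgroup G) [hZ : Z.Normal] {n u : G} (h : ⁅n, u⁆ ∈ Z) :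
    ∀ k : ℕ, ⁅n, u ^ k⁆ ∈ Z := by
  intro k
  induction k with
  | zero => simp
  | succ k ih =>
    rw [pow_succ, commutatorElement_mul_right_eq_mul_conj]
    have : ⁅n, u ^ k⁆ * u ^ k * ⁅n, u⁆ * (u ^ k)⁻¹ = ⁅n, u ^ k⁆ * (u ^ k * ⁅n, u⁆ * (u ^ k)⁻¹) := by
      group
    rw [this]
    exact Z.mul_mem ih (hZ.conj_mem _ h _)

/-- `⁅n, u * y⁆ ≡ ⁅n, u⁆` modulo a normal subgroup `Z` containing `⁅n, y⁆`. [folklore] -/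
private theorem commutator_mul_right_mem_iff (Z : Subgroup G) [hZ : Z.Normal] {n u y : G}
    (hy : ⁅n, y⁆ ∈ Z) : ⁅n, u * y⁆ ∈ Z ↔ ⁅n, u⁆ ∈ Z := by
  rw [commutatorElement_mul_right_eq_mul_conj]
  have hc : u * ⁅n, y⁆ * u⁻¹ ∈ Z := hZ.conj_mem _ hy u
  constructor
  · intro h
    have : ⁅n, u⁆ = ⁅n, u⁆ * u * ⁅n, y⁆ * u⁻¹ * (u * ⁅n, y⁆ * u⁻¹)⁻¹ := by group
    rw [this]
    exact Z.mul_mem h (Z.inv_mem hc)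
  · intro h
    have : ⁅n, u⁆ * u * ⁅n, y⁆ * u⁻¹ = ⁅n, u⁆ * (u * ⁅n, y⁆ * u⁻¹) := by group
    rw [this]
    exact Z.mul_mem h hc

/-- `⁅g n g⁻¹, u⁆ ∈ Z ↔ ⁅n, g⁻¹ u g⁆ ∈ Z` for a normal subgroup `Z`. [folklore] -/
private theorem commutator_conj_mem_iff (Z : Subgroup G) [hZ : Z.Normal] (n u g : G) :
    ⁅g * n * g⁻¹, u⁆ ∈ Z ↔ ⁅n, g⁻¹ * u * g⁆ ∈ Z := by
  have key : ⁅g * n * g⁻¹, u⁆ = g * ⁅n, g⁻¹ * u * g⁆ * g⁻¹ := by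
    simp only [commutatorElement_def]; group
  rw [key]
  constructor
  · intro h
    have := hZ.conj_mem _ h g⁻¹
    simpa [mul_assoc] using this
  · intro h
    exact hZ.conj_mem _ h g

/-- The set `{n ∈ N | ⁅n, u⁆ ∈ Z}` is closed under multiplication and inverses when `Z ⊴ G`
(so it is a subgroup).  We record the two closure properties. [folklore] -/
private theorem commutator_mem_mul (Z : Subgroup G) [hZ : Z.Normal] {n n' u : G}
    (hn : ⁅n, u⁆ ∈ Z) (hn' : ⁅n', u⁆ ∈ Z) : ⁅n * n', u⁆ ∈ Z := by
  rw [commutatorElement_mul_left_eq_conj_mul]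
  have : n * ⁅n', u⁆ * n⁻¹ * ⁅n, u⁆ = (n * ⁅n', u⁆ * n⁻¹) * ⁅n, u⁆ := by group
  rw [this]
  exact Z.mul_mem (hZ.conj_mem _ hn' n) hn

/-- Inverse-closure of `{n | ⁅n, u⁆ ∈ Z}` for a normal subgroup `Z`. [folklore] -/
private theorem commutator_mem_inv (Z : Subgroup G) [hZ : Z.Normal] {n u : G}
    (hn : ⁅n, u⁆ ∈ Z) : ⁅n⁻¹, u⁆ ∈ Z := by
  rw [commutatorElement_inv_left]
  have : n⁻¹ * ⁅u, n⁆ * n = n⁻¹ * ⁅n, u⁆⁻¹ * n⁻¹⁻¹ := by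
    rw [← commutatorElement_inv]; group
  rw [this]
  exact hZ.conj_mem _ (Z.inv_mem hn) n⁻¹

/-! ### Fixed-point-freeness passes to conjugates -/

/-- **Conjugates of a fixed-point-free element are fixed-point-free.** If `N, Z ⊴ G` and
`⁅n, u⁆ ∈ Z → n ∈ Z` for all `n ∈ N`, then the same holds for every conjugate `g u g⁻¹`.
[cite: NikolovSegal2007, §4] -/
theorem fpf_conj (N Z : Subgroup G) [hN : N.Normal] [hZ : Z.Normal] {u : G}
    (hu : ∀ n ∈ N, ⁅n, u⁆ ∈ Z → n ∈ Z) (g : G) :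
    ∀ n ∈ N, ⁅n, g * u * g⁻¹⁆ ∈ Z → n ∈ Z := by
  intro n hn h
  -- `⁅n, g u g⁻¹⁆ = g ⁅g⁻¹ n g, u⁆ g⁻¹`
  have h1 : ⁅g⁻¹ * n * g⁻¹⁻¹, u⁆ ∈ Z := by
    rw [commutator_conj_mem_iff Z]
    simpa [mul_assoc] using h
  have h2 : g⁻¹ * n * g⁻¹⁻¹ ∈ Z := hu _ (hN.conj_mem _ hn g⁻¹) h1
  have := hZ.conj_mem _ h2 g
  simpa [mul_assoc] using this

/-! ### The dichotomy for `t` -/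

/-- **Dichotomy for `t`.** Let `P, N, Z ⊴ G` with `⁅N, P⁆ ≤ Z`, suppose every `G`-normal subgroup `A`
with `Z ≤ A < N`... precisely: every normal `A < N` satisfies `A ≤ Z` (so `N/Z` is a chief factor), and
`(T1)`: every conjugate of `t` lies in `⟨t⟩ P`.  Then either `t` acts fixed-point-freely on `N/Z`
(`∀ n ∈ N, ⁅n,t⁆ ∈ Z → n ∈ Z`) or trivially (`∀ n ∈ N, ⁅n,t⁆ ∈ Z`): the subgroup
`A_t = {n ∈ N | ⁅n,t⁆ ∈ Z}` is `G`-normal. [cite: NikolovSegal2007, §4] -/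
theorem fpf_or_triv_of_conj_mem_zpowers_mul (P N Z : Subgroup G) [hN : N.Normal]
    [hZ : Z.Normal] (t : G) (hNPZ : ⁅N, P⁆ ≤ Z)
    (hZmax : ∀ A : Subgroup G, A.Normal → A < N → A ≤ Z)
    (ht_conj : ∀ g : G, ∃ a : ℕ, ∃ y ∈ P, g * t * g⁻¹ = t ^ a * y) :
    (∀ n ∈ N, ⁅n, t⁆ ∈ Z → n ∈ Z) ∨ (∀ n ∈ N, ⁅n, t⁆ ∈ Z) := by
  -- the subgroup `A = {n ∈ N | ⁅n, t⁆ ∈ Z}`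
  let A : Subgroup G :=
    { carrier := {n | n ∈ N ∧ ⁅n, t⁆ ∈ Z}
      mul_mem' := fun {a b} ha hb => ⟨N.mul_mem ha.1 hb.1, commutator_mem_mul Z ha.2 hb.2⟩
      one_mem' := ⟨N.one_mem, by simp⟩
      inv_mem' := fun {a} ha => ⟨N.inv_mem ha.1, commutator_mem_inv Z ha.2⟩ }
  have hAN : A ≤ N := fun n hn => hn.1
  -- `A` is normal: `⁅g n g⁻¹, t⁆ ∈ Z ⟺ ⁅n, g⁻¹ t g⁆ ∈ Z`, and `g⁻¹ t g = t^a y`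
  have hAn : A.Normal := by
    refine ⟨fun n hn g => ⟨hN.conj_mem _ hn.1 g, ?_⟩⟩
    rw [commutator_conj_mem_iff Z]
    obtain ⟨a, y, hy, hay⟩ := ht_conj g⁻¹
    have hg : g⁻¹ * t * g = t ^ a * y := by simpa using hay
    rw [hg, commutator_mul_right_mem_iff Z (hNPZ (Subgroup.commutator_mem_commutator hn.1 hy))]
    exact commutator_pow_mem Z hn.2 a
  by_cases hAeq : A = N
  · right
    intro n hn
    have : n ∈ A := by rw [hAeq]; exact hn
    exact this.2
  · left
    have hAlt : A < N := lt_of_le_of_ne hAN hAeq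
    have hAZ : A ≤ Z := hZmax A hAn hAlt
    intro n hn h
    exact hAZ ⟨hn, h⟩

/-- **If `t` acts trivially on the chief factor then `s` acts fixed-point-freely.** With `(T3)`
(conjugates of `s` lie in `⟨t⟩ s P`), `(T4)` (`G` generated by `P ∪ {t, s}`) and `⁅N, G⁆ = N ≠ Z`:
if `⁅n, t⁆ ∈ Z` for all `n ∈ N` then `⁅n, s⁆ ∈ Z → n ∈ Z` for `n ∈ N` (otherwise `A_s = N` and
`N/Z` is central, i.e. `⁅N, G⁆ ≤ Z < N`). [cite: NikolovSegal2007, §4] -/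
theorem fpf_s_of_triv_t (P N Z : Subgroup G) [hN : N.Normal] [hZ : Z.Normal]
    (t s : G) (hNPZ : ⁅N, P⁆ ≤ Z) (hZN : Z < N) (hNG : ⁅N, (⊤ : Subgroup G)⁆ = N)
    (hZmax : ∀ A : Subgroup G, A.Normal → A < N → A ≤ Z)
    (hs_conj : ∀ g : G, ∃ a : ℕ, ∃ y ∈ P, g * s * g⁻¹ = t ^ a * s * y)
    (hGgen : Subgroup.closure ((P : Set G) ∪ {t, s}) = ⊤)
    (ht_triv : ∀ n ∈ N, ⁅n, t⁆ ∈ Z) :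
    ∀ n ∈ N, ⁅n, s⁆ ∈ Z → n ∈ Z := by
  -- the subgroup `A = {n ∈ N | ⁅n, s⁆ ∈ Z}`
  let A : Subgroup G :=
    { carrier := {n | n ∈ N ∧ ⁅n, s⁆ ∈ Z}
      mul_mem' := fun {a b} ha hb => ⟨N.mul_mem ha.1 hb.1, commutator_mem_mul Z ha.2 hb.2⟩
      one_mem' := ⟨N.one_mem, by simp⟩
      inv_mem' := fun {a} ha => ⟨N.inv_mem ha.1, commutator_mem_inv Z ha.2⟩ }
  have hAN : A ≤ N := fun n hn => hn.1
  have hAn : A.Normal := by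
    refine ⟨fun n hn g => ⟨hN.conj_mem _ hn.1 g, ?_⟩⟩
    rw [commutator_conj_mem_iff Z]
    obtain ⟨a, y, hy, hay⟩ := hs_conj g⁻¹
    have hg : g⁻¹ * s * g = t ^ a * s * y := by simpa using hay
    rw [hg, commutator_mul_right_mem_iff Z (hNPZ (Subgroup.commutator_mem_commutator hn.1 hy)),
      commutatorElement_mul_right_eq_mul_conj]
    have h1 : ⁅n, t ^ a⁆ ∈ Z := commutator_pow_mem Z (ht_triv n hn.1) a
    have h2 : t ^ a * ⁅n, s⁆ * (t ^ a)⁻¹ ∈ Z := hZ.conj_mem _ hn.2 _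
    have : ⁅n, t ^ a⁆ * t ^ a * ⁅n, s⁆ * (t ^ a)⁻¹ = ⁅n, t ^ a⁆ * (t ^ a * ⁅n, s⁆ * (t ^ a)⁻¹) := by
      group
    rw [this]
    exact Z.mul_mem h1 h2
  -- `A ≠ N`: otherwise `⁅N, G⁆ ≤ Z`
  have hAne : A ≠ N := by
    intro hAeq
    have hall : ∀ g : G, ∀ n ∈ N, ⁅n, g⁆ ∈ Z := by
      -- the set of such `g` is a subgroup containing `P`, `t`, `s`
      let S : Subgroup G :=
        { carrier := {g | ∀ n ∈ N, ⁅n, g⁆ ∈ Z}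
          mul_mem' := fun {g h} hg hh n hn => by
            rw [commutatorElement_mul_right_eq_mul_conj]
            have : ⁅n, g⁆ * g * ⁅n, h⁆ * g⁻¹ = ⁅n, g⁆ * (g * ⁅n, h⁆ * g⁻¹) := by group
            rw [this]
            exact Z.mul_mem (hg n hn) (hZ.conj_mem _ (hh n hn) g)
          one_mem' := fun n _ => by simp
          inv_mem' := fun {g} hg n hn => by
            rw [commutatorElement_inv_right]
            have : g⁻¹ * ⁅g, n⁆ * g = g⁻¹ * ⁅n, g⁆⁻¹ * g⁻¹⁻¹ := by
              rw [← commutatorElement_inv]; group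
            rw [this]
            exact hZ.conj_mem _ (Z.inv_mem (hg n hn)) g⁻¹ }
      have hS : (⊤ : Subgroup G) ≤ S := by
        rw [← hGgen, Subgroup.closure_le]
        rintro g (hg | hg | hg)
        · exact fun n hn => hNPZ (Subgroup.commutator_mem_commutator hn hg)
        · subst hg; exact ht_triv
        · have : g = s := hg
          subst this
          intro n hn
          have : n ∈ A := by rw [hAeq]; exact hn
          exact this.2
      intro g n hn
      exact hS (Subgroup.mem_top g) n hn
    have hNZ : ⁅N, (⊤ : Subgroup G)⁆ ≤ Z := by
      rw [Subgroup.commutator_le]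
      exact fun n hn g _ => hall g n hn
    rw [hNG] at hNZ
    exact absurd hNZ (not_le_of_gt hZN)
  have hAlt : A < N := lt_of_le_of_ne hAN hAne
  have hAZ : A ≤ Z := hZmax A hAn hAlt
  intro n hn h
  exact hAZ ⟨hn, h⟩

/-! ### Solvability on a fixed-point-free chief factor -/

/-- **Solving `⁅a, u⁆ ≡ κ (mod Z)`.** Let `Z ≤ N` be normal subgroups of a finite group with `⁅N, N⁆ ≤ Z`,
and let `u ∈ G` normalise... (`N ⊴ G`) act fixed-point-freely on `N/Z`: `⁅n, u⁆ ∈ Z → n ∈ Z` for `n ∈ N`.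
Then `n ↦ ⁅n, u⁆ Z` is a homomorphism `N → N/Z` with kernel `Z`, hence onto:
for every `κ ∈ N` there is `a ∈ N` with `κ⁻¹ * ⁅a, u⁆ ∈ Z`. [cite: NikolovSegal2007, §4] -/
theorem exists_commutator_inv_mul_mem_of_fpf [Finite G] (N Z : Subgroup G) [hN : N.Normal]
    [hZ : Z.Normal] (hNN : ⁅N, N⁆ ≤ Z) (u : G)
    (hu : ∀ n ∈ N, ⁅n, u⁆ ∈ Z → n ∈ Z) :
    ∀ κ ∈ N, ∃ a ∈ N, κ⁻¹ * ⁅a, u⁆ ∈ Z := by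
  classical
  let mk := QuotientGroup.mk' Z
  -- the homomorphism `f : N → G ⧸ Z`, `n ↦ ⁅n, u⁆ Z`
  have hmem : ∀ n ∈ N, ⁅n, u⁆ ∈ N := fun n hn => by
    rw [commutatorElement_def]
    have : n * u * n⁻¹ * u⁻¹ = n * (u * n⁻¹ * u⁻¹) := by group
    rw [this]
    exact N.mul_mem hn (hN.conj_mem _ (N.inv_mem hn) u)
  have hcomm : ∀ x ∈ N, ∀ y ∈ N, mk x * mk y = mk y * mk x := by
    intro x hx y hy
    rw [← map_mul, ← map_mul, QuotientGroup.mk'_apply, QuotientGroup.mk'_apply, QuotientGroup.eq]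
    have : (x * y)⁻¹ * (y * x) = ⁅y⁻¹, x⁻¹⁆ := by simp only [commutatorElement_def]; group
    rw [this]
    exact hNN (Subgroup.commutator_mem_commutator (N.inv_mem hy) (N.inv_mem hx))
  let f : N →* G ⧸ Z :=
    { toFun := fun n => mk ⁅(n : G), u⁆
      map_one' := by simp
      map_mul' := fun a b => by
        simp only [Subgroup.coe_mul]
        rw [commutatorElement_mul_left_eq_conj_mul, map_mul]
        -- `mk (a ⁅b,u⁆ a⁻¹) = mk ⁅b,u⁆` since `⁅a, ⁅b,u⁆⁆ ∈ ⁅N,N⁆ ≤ Z`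
        have h1 : mk ((a : G) * ⁅(b : G), u⁆ * (a : G)⁻¹) = mk ⁅(b : G), u⁆ := by
          rw [QuotientGroup.mk'_apply, QuotientGroup.mk'_apply, QuotientGroup.eq]
          have : ((a : G) * ⁅(b : G), u⁆ * (a : G)⁻¹)⁻¹ * ⁅(b : G), u⁆ = ⁅(a : G), ⁅(b:G), u⁆⁻¹⁆ := by
            simp only [commutatorElement_def]; group
          rw [this]
          exact hNN (Subgroup.commutator_mem_commutator a.2 (N.inv_mem (hmem _ b.2)))
        rw [h1, hcomm _ (hmem _ b.2) _ (hmem _ a.2)] }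
  -- kernel of `f` is `Z ∩ N`
  have hker : f.ker = Z.subgroupOf N := by
    ext n
    rw [MonoidHom.mem_ker, Subgroup.mem_subgroupOf]
    change mk ⁅(n : G), u⁆ = 1 ↔ _
    rw [QuotientGroup.mk'_apply, QuotientGroup.eq_one_iff]
    exact ⟨hu _ n.2, fun h => by
      have hzu : ⁅(n : G), u⁆ ∈ ⁅Z, (⊤ : Subgroup G)⁆ :=
        Subgroup.commutator_mem_commutator h (Subgroup.mem_top u)
      exact Subgroup.commutator_le_left Z ⊤ hzu⟩
  -- the projection `π : N → G ⧸ Z` has the same kernel and range `N.map mk`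
  let π : N →* G ⧸ Z := mk.restrict N
  have hπker : π.ker = Z.subgroupOf N := by
    rw [MonoidHom.ker_restrict, QuotientGroup.ker_mk']
  have hrange_le : f.range ≤ π.range := by
    rintro _ ⟨n, rfl⟩
    exact ⟨⟨⁅(n : G), u⁆, hmem _ n.2⟩, rfl⟩
  have hcard : Nat.card π.range ≤ Nat.card f.range := by
    rw [← Subgroup.index_ker, ← Subgroup.index_ker, hker, hπker]
  have hrange : f.range = π.range := Subgroup.eq_of_le_of_card_ge hrange_le hcard
  -- conclude
  intro κ hκ
  have : mk κ ∈ f.range := by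
    rw [hrange]
    exact ⟨⟨κ, hκ⟩, rfl⟩
  obtain ⟨a, ha⟩ := this
  refine ⟨a, a.2, ?_⟩
  have ha' : mk ⁅(a : G), u⁆ = mk κ := ha
  rw [QuotientGroup.mk'_apply, QuotientGroup.mk'_apply, eq_comm, QuotientGroup.eq] at ha'
  exact ha'

end Literature.GroupTheory
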